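import Summits.BirchSwinnertonDyer.Rank1Residual.Additive.SignedTwistPlusSelmerLayer
import Summits.BirchSwinnertonDyer.Rank1Residual.Additive.SignedTwistSelmerInftyEta
import HarnessLib

/-!
# The signed-`η` twist dictionary at the infinite level FOR ANY SIGN whose layer dictionary holds,
# and the PLUS instance (D3⁺): `Θ_∞ (Sel⁺(W/ℚ_∞)) = Sel⁺(V/K₀ℚ_∞)^η`
(cell `bsd-potss`, seat `bsd-potss-ctrl` g2; fourth brick of T-e2-R1⁺ = the plus twin of x1b's
P5-4b/4b′ `SignedTwistSelmerInfty(Eta)` (D3); TARGET.md v6 §0.12 (e))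

HONEST FRAMING (cell `bsd-potss`, run/shared/lean/pub/bsd-potss/; FULL-BSD rank ≤ 1 programme,
tranche 1b): TOOL THEOREMS ONLY — no definition, no named Literature fact, no Summits-side fact
`def … : Prop`, no `sorry`, axioms standard; binders exactly as x1b's (D3); nothing is booked; no
label / mark / count moves; nothing about (C1_η) or `BSD(W, p)` is claimed.

## What
x1b's (D3) (`map_h1TransportInfty_strictSignedSelmerInfty`, sign `−1`) uses the sign ONLY through the
layer dictionary (D2). §1 re-runs x1b's three proofs (⊆; the `η`-average of a restricted layer class
is hit up to `[Γ:G₀]`; ⊇ by averaging over representatives of `ker κ/U_∞`) for an ARBITRARY sign `ε`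
under the HYPOTHESIS `hlayer` = (D2) at `ε` at every layer (a plain `∀ n x, _ ↔ _`, no `Prop`
definition): `map_h1TransportInfty_strictSignedSelmerInfty_of_layer`,
`mem_strictSignedSelmerInfty_iff_h1TransportInfty_of_layer`. §2 THE PLUS INSTANCE, `hlayer`
discharged by (D2⁺) `mem_strictSignedSelmerLayer_one_iff_h1TransportLayer`:
**`map_h1TransportInfty_strictSignedSelmerInfty_one`** —
`Θ_∞ (strictSignedSelmerInfty W κ E 1) = towerSignedSelmerInftyEta V κ K₀ E η 1`, i.e.
**`X⁺_W(ℚ_∞)` IS `X⁺(V/K₀ℚ_∞)^η` at the Selmer level** — and its membership form.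

References: [Kobayashi2003] Def. 2.1 (p. 5), §4 p. 8 (`M^η = ε_η M`); [DokchitserDokchitserAnnals2010]
Lemma 4.14 (proof); [GreenbergLNM1716] §5 p. 143.
-/

noncomputable section

open scoped Classical

open WeierstrassCurve Field

namespace Summit.BirchSwinnertonDyer.Rank1Residual.Additive.SignedTwist

open Literature.NumberTheory.EllipticCurves Literature.NumberTheory.GaloisRepresentations
  Literature.NumberTheory.EllipticCurves.Kobayashi2003
  Summit.BirchSwinnertonDyer.Rank1Residual.AdditivePotMult ZpExtension

variable (W : WeierstrassCurve ℚ) (K₀ : Type) [Field K₀] [NumberField K₀] {θ : K₀} {c : ℚ}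
  (hθ : θ ∉ Set.range (algebraMap ℚ K₀)) (hc : θ ^ 2 = algebraMap ℚ K₀ c)
  (p : ℕ) [Fact p.Prime] (κ : ZpExtension ℚ p)
  {V : WeierstrassCurve ℚ} {C : VariableChange ℚ} (hCV : C • W.quadraticTwist c = V)
  (E : Type) [Field E] [Algebra ℚ E]
  (η : absoluteGaloisGroup ℚ →* ℤˣ)
  (hη : ∀ σ : absoluteGaloisGroup ℚ, η σ = 1 ↔ σ • rootInClosure K₀ θ = rootInClosure K₀ θ)

/-! ## §1 Any sign, given the layer dictionary -/

section AnySign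

variable [(galRange (K := ℚ) K₀).Normal] (ε : ℤˣ)
  (hlayer : ∀ (n : ℕ) (x : W.subgroupH1 p (κ.layerSubgroup n)),
    x ∈ strictSignedSelmerLayer W κ E ε n ↔
      h1TransportLayer W K₀ hθ hc p κ hCV n x ∈ towerSignedSelmerLayer V κ K₀ E ε n)

include hη hlayer in
/-- **(D3, ⊆) at any sign with a layer dictionary**: `Θ_∞ (Sel^{ε,str}(W/ℚ_∞)) ⊆ Sel^ε(V/K₀ℚ_∞)^η`
(layer by layer by `hlayer` and the square; `η`-eigen by `conjH1_h1TransportInfty_of_mem_ker`).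
[cite: Kobayashi2003, Def. 2.1 (p. 5), §4 p. 8] -/
theorem map_h1TransportInfty_strictSignedSelmerInfty_le_of_layer :
    (strictSignedSelmerInfty W κ E ε).map (h1TransportInfty W K₀ hθ hc p κ hCV) ≤
      towerSignedSelmerInftyEta V κ K₀ E η ε := by
  rw [AddSubgroup.map_le_iff_le_comap]
  refine (iSup_le fun n ↦ ?_ :
    (⨆ n : ℕ, (strictSignedSelmerLayer W κ E ε n).map (W.layerToInfty κ n)) ≤ _)
  rw [AddSubgroup.map_le_iff_le_comap]
  intro x hx
  rw [AddSubgroup.mem_comap, AddSubgroup.mem_comap, mem_towerSignedSelmerInftyEta_iff]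
  refine ⟨?_, fun σ hσ ↦ conjH1_h1TransportInfty_of_mem_ker W K₀ hθ hc p κ hCV η hη hσ _⟩
  rw [h1TransportInfty_layerToInfty]
  exact map_resOfLe_towerSignedSelmerLayer_le V κ K₀ E ε n ⟨_, (hlayer n x).mp hx, rfl⟩

include hη hlayer in
/-- **The `η`-average of a restricted layer class is hit, up to `[Γ_ℚ : Gal(ℚ̄/K₀)]`** (any sign
with a layer dictionary): for `d ∈ Sel^ε(V/K₀ℚ_n)` and representatives `r_i ∈ L_n` of `L_n/U_n`,
`[Γ:G₀] · Σ_i η(r_i)·conj_{r_i} (res d) ∈ Θ_∞ (Sel^{ε,str}(W/ℚ_∞))`. x1b's proof verbatim.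
[cite: Kobayashi2003, Def. 2.1 (p. 5), §4 p. 8] [cite: DokchitserDokchitserAnnals2010, Lemma 4.14 (proof)] -/
theorem index_nsmul_sum_eta_conjH1_resOfLe_mem_of_layer {ι : Type*} [Fintype ι] (r : ι → absoluteGaloisGroup ℚ) (n : ℕ)
    (hr : ∀ i, r i ∈ κ.layerSubgroup n)
    (hbij : Function.Bijective fun i ↦ (QuotientGroup.mk (⟨r i, hr i⟩ : κ.layerSubgroup n) :
      κ.layerSubgroup n ⧸ (towerSubgroup κ K₀ n).subgroupOf (κ.layerSubgroup n)))
    {d : V.subgroupH1 p (towerSubgroup κ K₀ n)} (hd : d ∈ towerSignedSelmerLayer V κ K₀ E ε n) :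
    (galRange (K := ℚ) K₀).index •
        ∑ i, ((η (r i) : ℤˣ) : ℤ) • V.conjH1 p (towerTopSubgroup κ K₀) (r i)
          (V.resOfLe p (towerTopSubgroup_le κ K₀ n) d) ∈
      (strictSignedSelmerInfty W κ E ε).map (h1TransportInfty W K₀ hθ hc p κ hCV) := by
  have h1 := towerSubgroup_le_layerSubgroup K₀ p κ n
  have h2 := towerTopSubgroup_le κ K₀ n
  have hUn := towerSubgroup_le_galRange κ K₀ n
  obtain ⟨y, rfl⟩ : ∃ y, h1Transport W K₀ hθ hc p hCV (towerSubgroup κ K₀ n) hUn y = d :=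
    ⟨_, AddEquiv.apply_symm_apply _ d⟩
  have ha : ∑ i, ((η (r i) : ℤˣ) : ℤ) • V.conjH1 p (towerTopSubgroup κ K₀) (r i)
        (V.resOfLe p h2 (h1Transport W K₀ hθ hc p hCV (towerSubgroup κ K₀ n) hUn y)) =
      V.resOfLe p h2 (∑ i, ((η (r i) : ℤˣ) : ℤ) • V.conjH1 p (towerSubgroup κ K₀ n) (r i)
        (h1Transport W K₀ hθ hc p hCV (towerSubgroup κ K₀ n) hUn y)) := by
    rw [map_sum]
    refine Finset.sum_congr rfl fun i _ ↦ ?_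
    rw [map_zsmul, ← AddMonoidHom.comp_apply (V.conjH1 p (towerTopSubgroup κ K₀) (r i))
      (V.resOfLe p h2), ← resOfLe_comp_conjH1_holds (M := V.geomPrimaryTorsion p) h2 (r i),
      AddMonoidHom.comp_apply]
  have hb := sum_eta_smul_conjH1_h1Transport W K₀ hθ hc p hCV η hη r (towerSubgroup κ K₀ n) hUn y
  haveI : ((towerSubgroup κ K₀ n).subgroupOf (κ.layerSubgroup n)).FiniteIndex :=
    ⟨fun h0 ↦ Subgroup.FiniteIndex.index_ne_zero (H := galRange (K := ℚ) K₀)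
      (Nat.eq_zero_of_zero_dvd ((show (towerSubgroup κ K₀ n).relIndex (κ.layerSubgroup n) = 0
        from h0) ▸ relIndex_tower_layer_dvd K₀ p κ n))⟩
  have hopen : IsOpen (((towerSubgroup κ K₀ n).subgroupOf (κ.layerSubgroup n) :
      Subgroup (κ.layerSubgroup n)) : Set (κ.layerSubgroup n)) :=
    isOpen_subgroupOf_of_eq_inf (isOpen_galRange K₀) rfl
  have hinv : ∀ g : κ.layerSubgroup n,
      W.conjH1 p (towerSubgroup κ K₀ n) (g : absoluteGaloisGroup ℚ)
          (∑ i, W.conjH1 p (towerSubgroup κ K₀ n) (r i) y) =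
        ∑ i, W.conjH1 p (towerSubgroup κ K₀ n) (r i) y :=
    fun g ↦ conjH1_sum_conjH1_of_bijective W p r hr hbij g y
  obtain ⟨x, hx⟩ :=
    exists_resOfLe_eq_relIndex_nsmul_rel (W.geomPrimaryTorsion p) h1 hopen hinv
  have hsmem : ∑ i, ((η (r i) : ℤˣ) : ℤ) • V.conjH1 p (towerSubgroup κ K₀ n) (r i)
        (h1Transport W K₀ hθ hc p hCV (towerSubgroup κ K₀ n) hUn y) ∈
      towerSignedSelmerLayer V κ K₀ E ε n :=
    AddSubgroup.sum_mem _ fun i _ ↦ AddSubgroup.zsmul_mem _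
      (conjH1_mem_towerSignedSelmerLayer V κ K₀ E ε n (r i) hd) _
  have hΘx : h1TransportLayer W K₀ hθ hc p κ hCV n x =
      (towerSubgroup κ K₀ n).relIndex (κ.layerSubgroup n) •
        ∑ i, ((η (r i) : ℤˣ) : ℤ) • V.conjH1 p (towerSubgroup κ K₀ n) (r i)
          (h1Transport W K₀ hθ hc p hCV (towerSubgroup κ K₀ n) hUn y) := by
    rw [AddMonoidHom.comp_apply, AddMonoidHom.coe_coe]
    change h1Transport W K₀ hθ hc p hCV (towerSubgroup κ K₀ n) hUn
      (resOfLe (W.geomPrimaryTorsion p) h1 x) = _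
    rw [hx, map_nsmul, hb]
  have hxmem : x ∈ strictSignedSelmerLayer W κ E ε n := by
    rw [hlayer n x, hΘx]
    exact AddSubgroup.nsmul_mem _ hsmem _
  obtain ⟨k, hk⟩ := relIndex_tower_layer_dvd K₀ p κ n
  rw [ha, hk, mul_nsmul]
  refine AddSubgroup.nsmul_mem _ ?_ k
  refine ⟨W.layerToInfty κ n x,
    map_layerToInfty_strictSignedSelmerLayer_le W κ E ε n ⟨x, hxmem, rfl⟩, ?_⟩
  rw [h1TransportInfty_layerToInfty, hΘx, map_nsmul]

include hη hlayer in
/-- **(D3, ⊇) at any sign with a layer dictionary**: every `η`-eigenclass of `Sel^ε(V/K₀ℚ_∞)` is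
`Θ_∞` of a strict signed class (average over representatives of `ker κ/U_∞`; `[Γ:G₀]·|Q|` prime to
`p`; classes `p`-primary). x1b's proof verbatim.
[cite: Kobayashi2003, Def. 2.1 (p. 5), §4 p. 8 (M^η = ε_η M)] [cite: GreenbergLNM1716, §5 p. 143] -/
theorem towerSignedSelmerInftyEta_le_map_h1TransportInfty_of_layer
    (hκ₀ : ∀ x, ∃ g ∈ galRange (K := ℚ) K₀, κ g = x)
    (hcop : (galRange (K := ℚ) K₀).index.Coprime p) :
    towerSignedSelmerInftyEta V κ K₀ E η ε ≤
      (strictSignedSelmerInfty W κ E ε).map (h1TransportInfty W K₀ hθ hc p κ hCV) := by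
  intro t ht
  obtain ⟨ht, heig⟩ := (mem_towerSignedSelmerInftyEta_iff V κ K₀ E η ε t).mp ht
  haveI hFI : ((towerTopSubgroup κ K₀).subgroupOf κ.kerSubgroup).FiniteIndex :=
    ⟨fun h0 ↦ Subgroup.FiniteIndex.index_ne_zero (H := galRange (K := ℚ) K₀)
      (Nat.eq_zero_of_zero_dvd ((show (towerTopSubgroup κ K₀).relIndex κ.kerSubgroup = 0
        from h0) ▸ relIndex_towerTop_ker_dvd K₀ p κ))⟩
  haveI : Fintype (κ.kerSubgroup ⧸ (towerTopSubgroup κ K₀).subgroupOf κ.kerSubgroup) :=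
    Fintype.ofFinite _
  have hrk : ∀ q : κ.kerSubgroup ⧸ (towerTopSubgroup κ K₀).subgroupOf κ.kerSubgroup,
      ((Quotient.out q : κ.kerSubgroup) : absoluteGaloisGroup ℚ) ∈ κ.kerSubgroup :=
    fun q ↦ (Quotient.out q).2
  -- Step 1: `[Γ:G₀] · A(t') ∈ Θ_∞ (Sel^{ε,str}(W/ℚ_∞))` for every `t' ∈ Sel^ε(V/K₀ℚ_∞)`
  have havg : ∀ t' ∈ towerSignedSelmerInfty V κ K₀ E ε,
      (galRange (K := ℚ) K₀).index •
          ∑ q : κ.kerSubgroup ⧸ (towerTopSubgroup κ K₀).subgroupOf κ.kerSubgroup,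
            ((η ((Quotient.out q : κ.kerSubgroup) : absoluteGaloisGroup ℚ) : ℤˣ) : ℤ) •
              V.conjH1 p (towerTopSubgroup κ K₀)
                ((Quotient.out q : κ.kerSubgroup) : absoluteGaloisGroup ℚ) t' ∈
        (strictSignedSelmerInfty W κ E ε).map (h1TransportInfty W K₀ hθ hc p κ hCV) := by
    intro t' ht'
    refine AddSubgroup.iSup_induction
      (fun n ↦ (towerSignedSelmerLayer V κ K₀ E ε n).map
        (V.resOfLe p (towerTopSubgroup_le κ K₀ n)))
      (C := fun t' ↦ (galRange (K := ℚ) K₀).index •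
          ∑ q : κ.kerSubgroup ⧸ (towerTopSubgroup κ K₀).subgroupOf κ.kerSubgroup,
            ((η ((Quotient.out q : κ.kerSubgroup) : absoluteGaloisGroup ℚ) : ℤˣ) : ℤ) •
              V.conjH1 p (towerTopSubgroup κ K₀)
                ((Quotient.out q : κ.kerSubgroup) : absoluteGaloisGroup ℚ) t' ∈
        (strictSignedSelmerInfty W κ E ε).map (h1TransportInfty W K₀ hθ hc p κ hCV))
      ht' ?_ ?_ ?_
    · rintro n _ ⟨d, hd, rfl⟩
      obtain ⟨e, he⟩ := exists_equiv_kerQuotient_layerQuotient K₀ p κ hκ₀ n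
      have hbij : Function.Bijective
          fun q : κ.kerSubgroup ⧸ (towerTopSubgroup κ K₀).subgroupOf κ.kerSubgroup ↦
            (QuotientGroup.mk (⟨((Quotient.out q : κ.kerSubgroup) : absoluteGaloisGroup ℚ),
              κ.kerSubgroup_le_layerSubgroup n (hrk q)⟩ : κ.layerSubgroup n) :
              κ.layerSubgroup n ⧸ (towerSubgroup κ K₀ n).subgroupOf (κ.layerSubgroup n)) := by
        convert e.bijective using 1
        funext q
        conv_rhs => rw [← QuotientGroup.out_eq' q, he]
        rfl
      exact index_nsmul_sum_eta_conjH1_resOfLe_mem_of_layer W K₀ hθ hc p κ hCV E η hη ε hlayer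
        _ n _ hbij hd
    · rw [Finset.sum_eq_zero fun q _ ↦ by rw [map_zero, zsmul_zero], nsmul_zero]
      exact zero_mem _
    · intro a b ha hb
      have hsplit : ∑ q : κ.kerSubgroup ⧸ (towerTopSubgroup κ K₀).subgroupOf κ.kerSubgroup,
          ((η ((Quotient.out q : κ.kerSubgroup) : absoluteGaloisGroup ℚ) : ℤˣ) : ℤ) •
            V.conjH1 p (towerTopSubgroup κ K₀)
              ((Quotient.out q : κ.kerSubgroup) : absoluteGaloisGroup ℚ) (a + b) =
          ∑ q : κ.kerSubgroup ⧸ (towerTopSubgroup κ K₀).subgroupOf κ.kerSubgroup,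
            ((η ((Quotient.out q : κ.kerSubgroup) : absoluteGaloisGroup ℚ) : ℤˣ) : ℤ) •
              V.conjH1 p (towerTopSubgroup κ K₀)
                ((Quotient.out q : κ.kerSubgroup) : absoluteGaloisGroup ℚ) a +
          ∑ q : κ.kerSubgroup ⧸ (towerTopSubgroup κ K₀).subgroupOf κ.kerSubgroup,
            ((η ((Quotient.out q : κ.kerSubgroup) : absoluteGaloisGroup ℚ) : ℤˣ) : ℤ) •
              V.conjH1 p (towerTopSubgroup κ K₀)
                ((Quotient.out q : κ.kerSubgroup) : absoluteGaloisGroup ℚ) b := by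
        rw [← Finset.sum_add_distrib]
        exact Finset.sum_congr rfl fun q _ ↦ by rw [map_add, zsmul_add]
      rw [hsplit, nsmul_add]
      exact add_mem ha hb
  -- Step 2: on the `η`-eigenclass `t` the average is `|Q| • t`
  have hsum : ∑ q : κ.kerSubgroup ⧸ (towerTopSubgroup κ K₀).subgroupOf κ.kerSubgroup,
      ((η ((Quotient.out q : κ.kerSubgroup) : absoluteGaloisGroup ℚ) : ℤˣ) : ℤ) •
        V.conjH1 p (towerTopSubgroup κ K₀)
          ((Quotient.out q : κ.kerSubgroup) : absoluteGaloisGroup ℚ) t =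
      Fintype.card (κ.kerSubgroup ⧸ (towerTopSubgroup κ K₀).subgroupOf κ.kerSubgroup) • t := by
    refine (Finset.sum_congr rfl fun q _ ↦ ?_ : _ = ∑ _q : κ.kerSubgroup ⧸
      (towerTopSubgroup κ K₀).subgroupOf κ.kerSubgroup, t).trans ?_
    · rw [heig _ (hrk q), units_smul_units_smul]
    · rw [Finset.sum_const, Finset.card_univ]
  -- Step 3: `[Γ:G₀]·|Q|` is prime to `p` and `t` is `p`-primary
  have hcard : Fintype.card (κ.kerSubgroup ⧸ (towerTopSubgroup κ K₀).subgroupOf κ.kerSubgroup) ∣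
      (galRange (K := ℚ) K₀).index := by
    rw [← Nat.card_eq_fintype_card]
    exact relIndex_towerTop_ker_dvd K₀ p κ
  have hclosed : IsClosed ((towerTopSubgroup κ K₀ : Subgroup (absoluteGaloisGroup ℚ)) :
      Set (absoluteGaloisGroup ℚ)) :=
    κ.isClosed_kerSubgroup.inter (Subgroup.isClosed_of_isOpen _ (isOpen_galRange K₀))
  obtain ⟨j, hj⟩ := exists_pow_nsmul_eq_zero_subgroupH1_of_isClosed V p hclosed t
  have hmem := havg t ht
  rw [hsum, ← mul_nsmul'] at hmem
  exact mem_of_coprime_nsmul_mem p _ hj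
    (Nat.Coprime.mul_left hcop (Nat.Coprime.coprime_dvd_left hcard hcop)) hmem

include hη hlayer in
/-- **(D3) at any sign with a layer dictionary**: `Θ_∞ (Sel^{ε,str}(W/ℚ_∞)) = Sel^ε(V/K₀ℚ_∞)^η`.
[cite: Kobayashi2003, Def. 2.1 (p. 5), §4 p. 8] -/
theorem map_h1TransportInfty_strictSignedSelmerInfty_of_layer
    (hκ₀ : ∀ x, ∃ g ∈ galRange (K := ℚ) K₀, κ g = x)
    (hcop : (galRange (K := ℚ) K₀).index.Coprime p) :
    (strictSignedSelmerInfty W κ E ε).map (h1TransportInfty W K₀ hθ hc p κ hCV) =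
      towerSignedSelmerInftyEta V κ K₀ E η ε :=
  le_antisymm
    (map_h1TransportInfty_strictSignedSelmerInfty_le_of_layer W K₀ hθ hc p κ hCV E η hη ε hlayer)
    (towerSignedSelmerInftyEta_le_map_h1TransportInfty_of_layer W K₀ hθ hc p κ hCV E η hη ε hlayer
      hκ₀ hcop)

include hη hlayer in
/-- (D3) at any sign with a layer dictionary, membership form.
[cite: Kobayashi2003, Def. 2.1 (p. 5), §4 p. 8] -/
theorem mem_strictSignedSelmerInfty_iff_h1TransportInfty_of_layer
    (hκ₀ : ∀ x, ∃ g ∈ galRange (K := ℚ) K₀, κ g = x)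
    (hcop : (galRange (K := ℚ) K₀).index.Coprime p) (s : W.subgroupH1 p κ.kerSubgroup) :
    s ∈ strictSignedSelmerInfty W κ E ε ↔
      h1TransportInfty W K₀ hθ hc p κ hCV s ∈ towerSignedSelmerInftyEta V κ K₀ E η ε := by
  rw [← map_h1TransportInfty_strictSignedSelmerInfty_of_layer W K₀ hθ hc p κ hCV E η hη ε hlayer
    hκ₀ hcop]
  constructor
  · exact fun hs ↦ ⟨s, hs, rfl⟩
  · rintro ⟨s', hs', he⟩
    rwa [← h1TransportInfty_injective W K₀ hθ hc p κ hCV hcop he]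

end AnySign

/-! ## §2 The plus instance (D3⁺) -/

include hη in
/-- **(D3⁺) THE PLUS SELMER DICTIONARY AT THE TOP: `Θ_∞ (Sel⁺(W/ℚ_∞)) = Sel⁺(V/K₀ℚ_∞)^η`** —
p17's plus Selmer group of `W` over the cyclotomic `ℤ_p`-tower of `ℚ` (`strictSignedSelmerInfty W κ
E 1`; no strict clause on the plus side) IS, under `Θ_∞`, the `η`-component of cc-typer-6's verbatim
Kobayashi `Sel⁺(V/K_∞)`, `K_∞ = K₀ℚ_∞`. [cite: Kobayashi2003, Def. 2.1 (p. 5), §4 p. 8 (X⁺(E/K_∞)^η)] -/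
theorem map_h1TransportInfty_strictSignedSelmerInfty_one [(galRange (K := ℚ) K₀).Normal]
    (hD : ∀ g : absoluteGaloisGroup ℚ, ∃ τ : absoluteGaloisGroup E,
      (resGalOfEmb (closureEmb (K := ℚ) E) τ)⁻¹ * g ∈ towerTopSubgroup κ K₀)
    (hκ₀ : ∀ x, ∃ g ∈ galRange (K := ℚ) K₀, κ g = x)
    (hcop : (galRange (K := ℚ) K₀).index.Coprime p) :
    (strictSignedSelmerInfty W κ E 1).map (h1TransportInfty W K₀ hθ hc p κ hCV) =
      towerSignedSelmerInftyEta V κ K₀ E η 1 :=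
  map_h1TransportInfty_strictSignedSelmerInfty_of_layer W K₀ hθ hc p κ hCV E η hη 1
    (mem_strictSignedSelmerLayer_one_iff_h1TransportLayer W K₀ hθ hc p κ hCV E η hη hD hκ₀ hcop)
    hκ₀ hcop

include hη in
/-- **(D3⁺), membership form**: `s ∈ Sel⁺(W/ℚ_∞) ↔ Θ_∞ s ∈ Sel⁺(V/K₀ℚ_∞)^η`.
[cite: Kobayashi2003, Def. 2.1 (p. 5), §4 p. 8] -/
theorem mem_strictSignedSelmerInfty_one_iff_h1TransportInfty [(galRange (K := ℚ) K₀).Normal]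
    (hD : ∀ g : absoluteGaloisGroup ℚ, ∃ τ : absoluteGaloisGroup E,
      (resGalOfEmb (closureEmb (K := ℚ) E) τ)⁻¹ * g ∈ towerTopSubgroup κ K₀)
    (hκ₀ : ∀ x, ∃ g ∈ galRange (K := ℚ) K₀, κ g = x)
    (hcop : (galRange (K := ℚ) K₀).index.Coprime p) (s : W.subgroupH1 p κ.kerSubgroup) :
    s ∈ strictSignedSelmerInfty W κ E 1 ↔
      h1TransportInfty W K₀ hθ hc p κ hCV s ∈ towerSignedSelmerInftyEta V κ K₀ E η 1 :=
  mem_strictSignedSelmerInfty_iff_h1TransportInfty_of_layer W K₀ hθ hc p κ hCV E η hη 1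
    (mem_strictSignedSelmerLayer_one_iff_h1TransportLayer W K₀ hθ hc p κ hCV E η hη hD hκ₀ hcop)
    hκ₀ hcop s

end Summit.BirchSwinnertonDyer.Rank1Residual.Additive.SignedTwist

end
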